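import Literature.AlgebraicGeometry.GroupSchemes.GroupSchemeActionInvariantSubobject
import Literature.AlgebraicGeometry.RelativeSpec.TorsorQuotientDescent
import Mathlib.AlgebraicGeometry.Gluing
import Mathlib.AlgebraicGeometry.Morphisms.Finite
import Mathlib.AlgebraicGeometry.Morphisms.FiniteType
import Mathlib.AlgebraicGeometry.Morphisms.Separated
import HarnessLib

/-!
# Gluing the affine torsor quotients of the stable affine opens: the charted quotient datum
# ([MumfordAV1970] §7 Thm. p. 66 «we glue», §12 Thm. 1; [SGA3I] Exp. V §5; [GortzWedhorn2020] §(3.5) Prop. 3.10)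

Topic `Literature/AlgebraicGeometry/RelativeSpec`; namespace `Literature.AlgebraicGeometry.RelativeSpec.TorsorQuotient` (= ★
`TorsorQuotientDescent`).  Cell `hodgecm-mathlib` (D-0151), P6b wave B, DEALS v8 row (7) QB4′-G «SPINE: LOCALLY DIRECTED GLUE» (census Q5c of
CENSUS-Q-junction v1) on the road to №1 §Q `stub_L4B1uQ_quotientByFiniteFlatSubgroup` (quotient of an abelian scheme by a finite flat subgroup scheme).
Count-neutral capital on `--supports stmt-HodgeConjecture-24832`; HC_CM is proved only modulo the printed citations until rung 0 closes; nothing here is about HC.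

THE PRINT.  [MumfordAV1970] §7 Thm. p. 66 (finite group) and §12 Thm. 1 p. 111 (finite group scheme): «Since the orbit of any point is contained in an affine
open … `X` is covered by `G`-stable affine opens `U_α`; one takes `V_α = U_α ⧸ G` and glues»; [SGA3I] Exp. V §5 (passage des quotients affines au cas général);
[GortzWedhorn2020] §(3.5) Proposition 3.10 (gluing data: a scheme glued from the `U_i` along the `φ_ij`, the `ψ_i` open immersions, jointly covering; p. 73) — here realised by Mathlib `Scheme.IsLocallyDirected`; (Prop. 12.27, §(12.7), is the finite-GROUP affine model `Spec A → Spec A^G` of the chart quotients, not used as a token).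

ABSTRACT FORM proved here (the finite flat twin of ★ `RelativeSpec/FiniteGroupQuotientGluing`, with the automorphism group replaced by a group-scheme action
`[GrpObj G] [ModObj G X]` in `Over S` and «geometric quotient» by «fppf torsor square», ★ `TorsorQuotientDescent`).  INPUT: `X.left` separated; every point of `X`
lies in a `G`-stable affine open (`hcov`); and on EVERY `G`-stable affine open `U`, for every lift `a` of the action to `U`, a CHART PACKAGE (`hchart`): an affine
`Q_U` of finite type over `S` and `q : U ⟶ Q_U`, finite ∕ flat ∕ surjective, `a`-invariant, with cartesian torsor square `G × U ⇉ U → Q_U` (★ sheet (A)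
`FiniteFlatGroupSchemeQuotientAffine*` in ring form).  OUTPUT (`exists_chartedQuotientDatum`): `π : X ⟶ Q` over `S`, `G`-invariant, with open-immersion charts
`ι_j : Q_{U_j} ⟶ Q` covering `Q`, cartesian CHART SQUARES `U_j = X ×_Q Q_{U_j}`, and the chart packages returned verbatim — the «charted quotient datum» that row (8)
pastes to the global torsor square and global finiteness ∕ flatness ∕ surjectivity of `π`.

ROAD.  §1 the index poset of stable affine opens (`⊓`-closed: Mathlib `IsAffineOpen.inf` under `X.left.IsSeparated`).  §2 a chosen chart package per index.  §3
TRANSITIONS for `U ≤ U'`: `U ↪ U' → Q_{U'}` is invariant, so it descends uniquely through `q_U` (★ `existsUnique_desc_of_isPullback`); its image `q_{U'}(U)` is an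
open (★ `isOpen_image_of_stable`) saturated (★ `preimage_image_eq_of_stable`) subscheme over which the restricted torsor square is again cartesian, so the
co-restriction `U → q_{U'}(U)` is ALSO a categorical quotient of `U` — two categorical quotients of `U` differ by a unique isomorphism, whence the transition
`Q_U ⟶ Q_{U'}` is an OPEN IMMERSION; functorial by uniqueness (★ `desc_unique`).  §4 the diagram is locally directed (a `q_{U_k}`-fibre meeting `U_i` and `U_j` is an
`a`-orbit, ★ `exists_eq_act_eq_snd`, and `U_i` is stable) and Mathlib glues it (`Scheme.IsLocallyDirected`); `π` is glued over the cover by the indices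
(`Scheme.Cover.glueMorphisms`); `π⁻¹(Q_U) = U` by saturation, so the chart squares are cartesian (`IsOpenImmersion.isPullback`).  §5 the HEAD.

## References
* [MumfordAV1970] D. Mumford, *Abelian Varieties* (1970), §7 Thm. p. 66 and its proof; §12 Thm. 1 (p. 111) and its proof (pp. 111–115).
* [SGA3I] M. Demazure, A. Grothendieck, *SGA 3* Tome I (LNM 151), Exp. V §4 Thm. 4.1, §5.
* [GortzWedhorn2020] U. Görtz, T. Wedhorn, *Algebraic Geometry I* (2nd ed., 2020), §(3.5) Prop. 3.10 (p. 73), Thm. 14.72.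
-/

set_option autoImplicit false

noncomputable section

universe u

open CategoryTheory CategoryTheory.Limits AlgebraicGeometry MonoidalCategory CartesianMonoidalCategory TopologicalSpace
open scoped MonObj

namespace Literature.AlgebraicGeometry.RelativeSpec.TorsorQuotient

open Literature.AlgebraicGeometry.GroupSchemes

variable {S : Scheme.{u}} {G X : Over S} [GrpObj G] [ModObj G X]

/-! ## §0 Opens of `X` as `S`-schemes; stability; the lifted action -/

variable (X) in
/-- The open `U ⊆ X` as an `S`-scheme `U → X → S` (non-Prop plumbing). [cite: MumfordAV1970, §7 Thm. p. 66 (proof)] -/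
abbrev openOver (U : X.left.Opens) : Over S := Over.mk (U.ι ≫ X.hom)

variable (X) in
/-- The inclusion `U ⟶ X` over `S` (non-Prop plumbing). [cite: MumfordAV1970, §7 Thm. p. 66 (proof)] -/
abbrev openOverι (U : X.left.Opens) : openOver X U ⟶ X := Over.homMk U.ι

variable (G) in
/-- **`U` is `G`-stable**: the action carries `G ×_S U` set-theoretically into `U` ([MumfordAV1970] §7: «`G`-stable affine opens»;
[MumfordFogartyKirwan1994] Ch. 3 Cor. 3.2: invariant open subsets). [cite: MumfordAV1970, §7 Thm. p. 66 (proof)] -/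
def IsStable (U : X.left.Opens) : Prop :=
  Set.range ((G ◁ openOverι X U) ≫ γ[G, X]).left ⊆ (U : Set ↥X.left)

/-- Unfolding of `IsStable`. [cite: MumfordAV1970, §7 Thm. p. 66 (proof)] -/
theorem isStable_iff (U : X.left.Opens) :
    IsStable G U ↔ Set.range ((G ◁ openOverι X U) ≫ γ[G, X]).left ⊆ (U : Set ↥X.left) :=
  Iff.rfl

/-- A stable open in ★ `ActionRestrict.liftOpen`'s spelling: `σ(G ×_S U) ⊆ range (U ↪ X)`. [cite: MumfordAV1970, §7 Thm. p. 66 (proof)] -/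
theorem IsStable.range_subset {U : X.left.Opens} (hU : IsStable G U) :
    Set.range ((G ◁ openOverι X U) ≫ γ[G, X]).left ⊆ Set.range (openOverι X U).left := by
  intro y hy
  have hy' : y ∈ Set.range U.ι := by rw [Scheme.Opens.range_ι]; exact hU hy
  exact hy'

variable (G) in
/-- **The action lifted to a stable open** (★ `ActionRestrict.liftOpen`): `a_U : G ×_S U ⟶ U`. [cite: MumfordAV1970, §7 Thm. p. 66 (proof)] -/
def actOpen (U : X.left.Opens) (hU : IsStable G U) : G ⊗ openOver X U ⟶ openOver X U :=
  haveI : IsOpenImmersion (openOverι X U).left := inferInstanceAs (IsOpenImmersion U.ι)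
  ActionRestrict.liftOpen (openOverι X U) (IsStable.range_subset hU)

/-- `a_U ≫ (U ↪ X) = (𝟙 × (U ↪ X)) ≫ σ` — the lift IS a lift. [cite: MumfordAV1970, §7 Thm. p. 66 (proof)] -/
@[reassoc]
theorem actOpen_comp (U : X.left.Opens) (hU : IsStable G U) :
    actOpen G U hU ≫ openOverι X U = (G ◁ openOverι X U) ≫ γ[G, X] := by
  haveI : IsOpenImmersion (openOverι X U).left := inferInstanceAs (IsOpenImmersion U.ι)
  exact ActionRestrict.liftOpen_comp (openOverι X U) (IsStable.range_subset hU)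

/-- The lift of the action to a stable open is UNIQUE (the inclusion is a monomorphism). [cite: MumfordAV1970, §7 Thm. p. 66 (proof)] -/
theorem eq_of_comp_openOverι_eq {U : X.left.Opens} {a a' : G ⊗ openOver X U ⟶ openOver X U}
    (ha : a ≫ openOverι X U = (G ◁ openOverι X U) ≫ γ[G, X]) (ha' : a' ≫ openOverι X U = (G ◁ openOverι X U) ≫ γ[G, X]) :
    a = a' := by
  haveI : IsOpenImmersion (openOverι X U).left := inferInstanceAs (IsOpenImmersion U.ι)
  haveI : Mono (openOverι X U) := ActionRestrict.mono_of_isOpenImmersion_left _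
  rw [← cancel_mono (openOverι X U), ha, ha']

/-! ## §1 The index poset: `G`-stable affine opens -/

variable (G X) in
/-- **The index poset**: `G`-stable AFFINE opens of `X` ([MumfordAV1970] §7: «`G`-stable affine open subsets `U_α`»). [cite: MumfordAV1970, §7 Thm. p. 66 (proof)] -/
abbrev StableAffineOpens : Type u :=
  { U : X.left.Opens // IsAffineOpen U ∧ IsStable G U }

namespace StableAffineOpens

/-- An index is affine. [cite: MumfordAV1970, §7 Thm. p. 66 (proof)] -/
theorem isAffineOpen (O : StableAffineOpens G X) : IsAffineOpen O.1 := O.2.1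

/-- An index is stable. [cite: MumfordAV1970, §7 Thm. p. 66 (proof)] -/
theorem isStable (O : StableAffineOpens G X) : IsStable G O.1 := O.2.2

/-- The inclusion of opens `U ↪ U'` over `S`, as a morphism of the `S`-schemes (non-Prop plumbing). [cite: MumfordAV1970, §7 Thm. p. 66 (proof)] -/
abbrev incl {U U' : X.left.Opens} (h : U ≤ U') : openOver X U ⟶ openOver X U' :=
  Over.homMk (X.left.homOfLE h) (by
    change X.left.homOfLE h ≫ U'.ι ≫ X.hom = U.ι ≫ X.hom
    rw [Scheme.homOfLE_ι_assoc])

/-- `incl ≫ (U' ↪ X) = (U ↪ X)`. [cite: MumfordAV1970, §7 Thm. p. 66 (proof)] -/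
@[reassoc (attr := simp)]
theorem incl_openOverι {U U' : X.left.Opens} (h : U ≤ U') : incl h ≫ openOverι X U' = openOverι X U := by
  ext : 1
  exact Scheme.homOfLE_ι _ h

/-- `incl h ≫ incl h' = incl (h.trans h')`. [cite: MumfordAV1970, §7 Thm. p. 66 (proof)] -/
@[reassoc (attr := simp)]
theorem incl_incl {U U' U'' : X.left.Opens} (h : U ≤ U') (h' : U' ≤ U'') : incl h ≫ incl h' = incl (h.trans h') := by
  ext : 1
  exact Scheme.homOfLE_homOfLE X.left h h'

/-- `incl le_rfl = 𝟙`. [cite: MumfordAV1970, §7 Thm. p. 66 (proof)] -/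
@[simp]
theorem incl_rfl (U : X.left.Opens) : incl (le_rfl : U ≤ U) = 𝟙 (openOver X U) := by
  ext : 1
  exact Scheme.homOfLE_rfl X.left U

/-- **The intersection of two stable opens is stable.** [cite: MumfordAV1970, §7 Thm. p. 66 (proof)] -/
theorem isStable_inf {U U' : X.left.Opens} (hU : IsStable G U) (hU' : IsStable G U') : IsStable G (U ⊓ U') := by
  rw [isStable_iff]
  rintro _ ⟨t, rfl⟩
  constructor
  · have h := hU ⟨((G ◁ incl (inf_le_left : U ⊓ U' ≤ U))).left t, rfl⟩
    rw [← incl_openOverι (inf_le_left : U ⊓ U' ≤ U), MonoidalCategory.whiskerLeft_comp, Category.assoc, Over.comp_left,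
      Scheme.Hom.comp_apply]
    exact h
  · have h := hU' ⟨((G ◁ incl (inf_le_right : U ⊓ U' ≤ U'))).left t, rfl⟩
    rw [← incl_openOverι (inf_le_right : U ⊓ U' ≤ U'), MonoidalCategory.whiskerLeft_comp, Category.assoc, Over.comp_left,
      Scheme.Hom.comp_apply]
    exact h

variable [X.left.IsSeparated]

/-- The intersection of two stable affine opens is another (affine since `X` is separated, Mathlib `IsAffineOpen.inf`). [cite: MumfordAV1970, §7 Thm. p. 66 (proof)] -/
def inf (O O' : StableAffineOpens G X) : StableAffineOpens G X :=
  ⟨O.1 ⊓ O'.1, O.2.1.inf O'.2.1, isStable_inf O.2.2 O'.2.2⟩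

/-- `O ⊓ O' ≤ O`. [cite: MumfordAV1970, §7 Thm. p. 66 (proof)] -/
theorem inf_le_left' (O O' : StableAffineOpens G X) : inf O O' ≤ O := (inf_le_left : O.1 ⊓ O'.1 ≤ O.1)

/-- `O ⊓ O' ≤ O'`. [cite: MumfordAV1970, §7 Thm. p. 66 (proof)] -/
theorem inf_le_right' (O O' : StableAffineOpens G X) : inf O O' ≤ O' := (inf_le_right : O.1 ⊓ O'.1 ≤ O'.1)

end StableAffineOpens

/-! ## §1b Stability is symmetric: `σ⁻¹ U = pr₂⁻¹ U` on `G ×_S X` -/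

omit [GrpObj G] [ModObj G X] in
/-- `(G ◁ f).left` for `f : T ⟶ T'` in `Over S` is the base change of `f.left` along `pr₂ : G ×_S T' → T'`. [cite: GortzWedhorn2020, Section (4.7) (pp. 107–108)] -/
private theorem isPullback_whiskerLeft_left_snd {T T' : Over S} (f : T ⟶ T') :
    IsPullback (G ◁ f).left (snd G T).left (snd G T').left f.left := by
  rw [Over.snd_left, Over.snd_left]
  refine IsPullback.of_right ?_ (Over.whiskerLeft_left_snd f) (IsPullback.of_hasPullback G.hom T'.hom)
  rw [Over.whiskerLeft_left_fst, Over.w f]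
  exact IsPullback.of_hasPullback G.hom T.hom

omit [GrpObj G] [ModObj G X] in
/-- `G ×_S U → G ×_S X` is an open immersion for an open `U ⊆ X`. [cite: GortzWedhorn2020, Section (4.7) (pp. 107–108)] -/
theorem isOpenImmersion_whiskerLeft_openOverι_left (U : X.left.Opens) : IsOpenImmersion (G ◁ openOverι X U).left :=
  MorphismProperty.of_isPullback (P := @IsOpenImmersion) (isPullback_whiskerLeft_left_snd (openOverι X U)).flip
    (inferInstanceAs (IsOpenImmersion U.ι))

omit [GrpObj G] [ModObj G X] in
/-- The points of `G ×_S U ⊆ G ×_S X` are exactly those whose second projection lies in `U`. [cite: GortzWedhorn2020, Section (4.7) (pp. 107–108)] -/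
theorem range_whiskerLeft_openOverι_left (U : X.left.Opens) :
    Set.range ((G ◁ openOverι X U).left) = (snd G X).left ⁻¹' (U : Set ↥X.left) := by
  have H := isPullback_whiskerLeft_left_snd (G := G) (openOverι X U)
  have e : (G ◁ openOverι X U).left = H.isoPullback.hom ≫ pullback.fst (snd G X).left (openOverι X U).left :=
    H.isoPullback_hom_fst.symm
  rw [e, Scheme.Hom.comp_base, TopCat.coe_comp, Set.range_comp,
    Set.range_eq_univ.mpr H.isoPullback.hom.surjective, Set.image_univ, Scheme.Pullback.range_fst]
  change _ ⁻¹' Set.range U.ι = _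
  rw [Scheme.Opens.range_ι]

/-- The «shear» `(g, x) ↦ (g⁻¹, g·x)` of `G ×_S X` exchanges `σ` and `pr₂` on points. [cite: MumfordFogartyKirwan1994, Ch. 0 §3, Def. 0.8 (pp. 9–10)] -/
theorem lift_inv_smul_comp_smul :
    lift (fst G X)⁻¹ (γ[G, X]) ≫ γ[G, X] = snd G X := by
  have hγ : fst G X • snd G X = γ[G, X] := by rw [Hom.smul_def, lift_fst_snd, Category.id_comp]
  calc lift (fst G X)⁻¹ (γ[G, X]) ≫ γ[G, X]
      = lift (fst G X)⁻¹ (γ[G, X]) ≫ (fst G X • snd G X) := by rw [hγ]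
    _ = (lift (fst G X)⁻¹ (γ[G, X]) ≫ fst G X) • (lift (fst G X)⁻¹ (γ[G, X]) ≫ snd G X) := ModObj.comp_smul _ _ _
    _ = (fst G X)⁻¹ • γ[G, X] := by rw [lift_fst, lift_snd]
    _ = (fst G X)⁻¹ • (fst G X • snd G X) := by rw [hγ]
    _ = snd G X := inv_smul_smul _ _

/-- **A stable open is saturated for the action on points of `G ×_S X`: `σ t ∈ U ↔ pr₂ t ∈ U`.** (`⇐`: a point with `pr₂ t ∈ U` comes from
`G ×_S U`, ★-range above; `⇒`: apply `⇐` to the sheared point `(g⁻¹, g·x)`.) [cite: MumfordAV1970, §12 Theorem 1 and its proof (pp. 111–115)] -/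
theorem IsStable.preimage_smul_eq {U : X.left.Opens} (hU : IsStable G U) :
    (γ[G, X]).left ⁻¹' (U : Set ↥X.left) = (snd G X).left ⁻¹' (U : Set ↥X.left) := by
  have key : ∀ t : ↥(G ⊗ X).left, (snd G X).left t ∈ (U : Set ↥X.left) → (γ[G, X]).left t ∈ (U : Set ↥X.left) := by
    intro t ht
    have ht' : t ∈ Set.range ((G ◁ openOverι X U).left) := by rw [range_whiskerLeft_openOverι_left]; exact ht
    obtain ⟨s, rfl⟩ := ht'
    refine hU ⟨s, ?_⟩
    rw [Over.comp_left, Scheme.Hom.comp_apply]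
  ext t
  refine ⟨fun ht => ?_, key t⟩
  -- `pr₂ t = σ (θ t)` with `pr₂ (θ t) = σ t ∈ U`
  have e1 : (snd G X).left t = (γ[G, X]).left ((lift (fst G X)⁻¹ (γ[G, X])).left t) := by
    rw [← Scheme.Hom.comp_apply, ← Over.comp_left, lift_inv_smul_comp_smul]
  have e2 : (snd G X).left ((lift (fst G X)⁻¹ (γ[G, X])).left t) = (γ[G, X]).left t := by
    rw [← Scheme.Hom.comp_apply, ← Over.comp_left, lift_snd]
  rw [Set.mem_preimage, e1]
  exact key _ (by rw [Set.mem_preimage] at ht; rw [e2]; exact ht)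

/-- The same read on a stable open `U ⊆ X` for a smaller stable open `U₀`: inside `G ×_S U`, `a_U t ∈ U₀ ↔ pr₂ t ∈ U₀` — the hypothesis of ★
`TorsorQuotient.preimage_image_eq_of_stable` ∕ `isOpen_image_of_stable` for the subset «`U₀` inside `U`». [cite: MumfordAV1970, §12 Theorem 1 and its proof (pp. 111–115)] -/
theorem IsStable.preimage_actOpen_eq {U U₀ : X.left.Opens} (hU : IsStable G U) (hU₀ : IsStable G U₀) :
    (actOpen G U hU).left ⁻¹' ((openOverι X U).left ⁻¹' (U₀ : Set ↥X.left)) =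
      (snd G (openOver X U)).left ⁻¹' ((openOverι X U).left ⁻¹' (U₀ : Set ↥X.left)) := by
  ext t
  simp only [Set.mem_preimage]
  have e1 : (openOverι X U).left ((actOpen G U hU).left t) = (γ[G, X]).left ((G ◁ openOverι X U).left t) := by
    have h := congrArg (fun φ => φ.left t) (actOpen_comp U hU)
    simp only [Over.comp_left, Scheme.Hom.comp_apply] at h
    exact h
  have e2 : (openOverι X U).left ((snd G (openOver X U)).left t) = (snd G X).left ((G ◁ openOverι X U).left t) := by
    have h := congrArg (fun φ => φ.left t) (whiskerLeft_snd G (openOverι X U))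
    simp only [Over.comp_left, Scheme.Hom.comp_apply] at h
    exact h.symm
  rw [e1, e2, ← Set.mem_preimage, hU₀.preimage_smul_eq, Set.mem_preimage]

/-! ## §1c The lifted actions are compatible with inclusions of stable opens -/

/-- The lifted actions are compatible with the inclusion of stable opens. [cite: MumfordAV1970, §7 Thm. p. 66 (proof)] -/
theorem actOpen_incl {U U' : X.left.Opens} (hU : IsStable G U) (hU' : IsStable G U') (h : U ≤ U') :
    actOpen G U hU ≫ StableAffineOpens.incl h = (G ◁ StableAffineOpens.incl h) ≫ actOpen G U' hU' := by
  haveI : IsOpenImmersion (openOverι X U').left := inferInstanceAs (IsOpenImmersion U'.ι)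
  haveI : Mono (openOverι X U') := ActionRestrict.mono_of_isOpenImmersion_left _
  rw [← cancel_mono (openOverι X U'), Category.assoc, StableAffineOpens.incl_openOverι, actOpen_comp, Category.assoc,
    actOpen_comp, ← MonoidalCategory.whiskerLeft_comp_assoc, StableAffineOpens.incl_openOverι]

/-! ## §2 The chosen chart package on each stable affine open -/

section Construction

variable (hchart : ∀ (U : X.left.Opens), IsAffineOpen U → ∀ (a : G ⊗ openOver X U ⟶ openOver X U),
    a ≫ openOverι X U = (G ◁ openOverι X U) ≫ γ[G, X] →
    ∃ (QU : Over S) (q : openOver X U ⟶ QU), IsAffine QU.left ∧ LocallyOfFiniteType QU.hom ∧ IsFinite q.left ∧ Flat q.left ∧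
      Surjective q.left ∧ a ≫ q = snd G (openOver X U) ≫ q ∧ IsPullback a.left (snd G (openOver X U)).left q.left q.left)

include hchart

/-- The chart package exists on every index (hypothesis `hchart` at the canonical lift `a_U`). [cite: MumfordAV1970, §12 Theorem 1 (p. 111)] -/
theorem chart_exists (O : StableAffineOpens G X) :
    ∃ (QU : Over S) (q : openOver X O.1 ⟶ QU), IsAffine QU.left ∧ LocallyOfFiniteType QU.hom ∧ IsFinite q.left ∧ Flat q.left ∧
      Surjective q.left ∧ actOpen G O.1 O.2.2 ≫ q = snd G (openOver X O.1) ≫ q ∧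
      IsPullback (actOpen G O.1 O.2.2).left (snd G (openOver X O.1)).left q.left q.left :=
  hchart O.1 O.2.1 (actOpen G O.1 O.2.2) (actOpen_comp O.1 O.2.2)

/-- **The affine quotient `Q_U` of the index `U`** (chosen from `hchart`). [cite: MumfordAV1970, §12 Theorem 1 (p. 111)] -/
def pieceQ (O : StableAffineOpens G X) : Over S := (chart_exists hchart O).choose

/-- **The quotient map `q_U : U ⟶ Q_U`** (chosen from `hchart`). [cite: MumfordAV1970, §12 Theorem 1 (p. 111)] -/
def pieceMk (O : StableAffineOpens G X) : openOver X O.1 ⟶ pieceQ hchart O := (chart_exists hchart O).choose_spec.choose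

/-- The chart package of the chosen quotient. [cite: MumfordAV1970, §12 Theorem 1 (p. 111)] -/
theorem piece_spec (O : StableAffineOpens G X) :
    IsAffine (pieceQ hchart O).left ∧ LocallyOfFiniteType (pieceQ hchart O).hom ∧ IsFinite (pieceMk hchart O).left ∧
      Flat (pieceMk hchart O).left ∧ Surjective (pieceMk hchart O).left ∧
      actOpen G O.1 O.2.2 ≫ pieceMk hchart O = snd G (openOver X O.1) ≫ pieceMk hchart O ∧
      IsPullback (actOpen G O.1 O.2.2).left (snd G (openOver X O.1)).left (pieceMk hchart O).left (pieceMk hchart O).left :=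
  (chart_exists hchart O).choose_spec.choose_spec

/-- `Q_U` is affine. [cite: MumfordAV1970, §12 Theorem 1 (p. 111)] -/
theorem isAffine_pieceQ (O : StableAffineOpens G X) : IsAffine (pieceQ hchart O).left := (piece_spec hchart O).1

/-- `Q_U → S` is locally of finite type. [cite: MumfordAV1970, §12 Theorem 1 (p. 111)] -/
theorem locallyOfFiniteType_pieceQ (O : StableAffineOpens G X) : LocallyOfFiniteType (pieceQ hchart O).hom := (piece_spec hchart O).2.1

/-- `q_U` is finite. [cite: MumfordAV1970, §12 Theorem 1 (p. 111)] -/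
theorem isFinite_pieceMk (O : StableAffineOpens G X) : IsFinite (pieceMk hchart O).left := (piece_spec hchart O).2.2.1

/-- `q_U` is flat. [cite: MumfordAV1970, §12 Theorem 1 (p. 111)] -/
theorem flat_pieceMk (O : StableAffineOpens G X) : Flat (pieceMk hchart O).left := (piece_spec hchart O).2.2.2.1

/-- `q_U` is surjective. [cite: MumfordAV1970, §12 Theorem 1 (p. 111)] -/
theorem surjective_pieceMk (O : StableAffineOpens G X) : Surjective (pieceMk hchart O).left := (piece_spec hchart O).2.2.2.2.1

/-- `q_U` is quasi-compact (it is finite, hence affine). [cite: GortzWedhorn2020, §(3.5) Proposition 3.10 and Example 3.11 (p. 73)] -/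
theorem quasiCompact_pieceMk (O : StableAffineOpens G X) : QuasiCompact (pieceMk hchart O).left := by
  haveI := isFinite_pieceMk hchart O
  infer_instance

/-- `q_U` is `G`-invariant: `a_U ≫ q_U = pr₂ ≫ q_U`. [cite: MumfordAV1970, §12 Theorem 1 (p. 111)] -/
theorem actOpen_pieceMk (O : StableAffineOpens G X) :
    actOpen G O.1 O.2.2 ≫ pieceMk hchart O = snd G (openOver X O.1) ≫ pieceMk hchart O := (piece_spec hchart O).2.2.2.2.2.1

/-- **The torsor square of `q_U` is cartesian**: `G ×_S U = U ×_{Q_U} U`. [cite: MumfordAV1970, §12 Theorem 1 (p. 111)] -/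
theorem isPullback_pieceMk (O : StableAffineOpens G X) :
    IsPullback (actOpen G O.1 O.2.2).left (snd G (openOver X O.1)).left (pieceMk hchart O).left (pieceMk hchart O).left :=
  (piece_spec hchart O).2.2.2.2.2.2

/-! ## §3 Transitions `Q_U ⟶ Q_{U'}` for `U ≤ U'`: unique descent, and they are open immersions -/

/-- `U ↪ U' → Q_{U'}` is invariant under `a_U`. [cite: MumfordAV1970, §7 Thm. p. 66 (proof)] -/
theorem actOpen_incl_pieceMk (O O' : StableAffineOpens G X) (h : O ≤ O') :
    actOpen G O.1 O.2.2 ≫ (StableAffineOpens.incl h ≫ pieceMk hchart O') =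
      snd G (openOver X O.1) ≫ (StableAffineOpens.incl h ≫ pieceMk hchart O') := by
  rw [← Category.assoc, actOpen_incl O.2.2 O'.2.2 h, Category.assoc, actOpen_pieceMk, ← Category.assoc, whiskerLeft_snd, Category.assoc]

/-- Unique descent through `q_U` of any `a_U`-invariant morphism (★ `existsUnique_desc_of_isPullback` at the chart package).
[cite: MumfordAV1970, §12 Theorem 1 and its proof (pp. 111–115)] -/
theorem existsUnique_desc_pieceMk (O : StableAffineOpens G X) {W : Over S} (f : openOver X O.1 ⟶ W)
    (hf : actOpen G O.1 O.2.2 ≫ f = snd G (openOver X O.1) ≫ f) : ∃! g : pieceQ hchart O ⟶ W, pieceMk hchart O ≫ g = f := by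
  haveI := flat_pieceMk hchart O
  haveI := surjective_pieceMk hchart O
  haveI := quasiCompact_pieceMk hchart O
  exact existsUnique_desc_of_isPullback _ _ _ (isPullback_pieceMk hchart O) f hf

/-- **The transition `Q_U ⟶ Q_{U'}`** for `U ≤ U'`: the unique descent of `U ↪ U' → Q_{U'}` through `q_U`. [cite: MumfordAV1970, §7 Thm. p. 66 (proof)] -/
def transition (O O' : StableAffineOpens G X) (h : O ≤ O') : pieceQ hchart O ⟶ pieceQ hchart O' :=
  (existsUnique_desc_pieceMk hchart O _ (actOpen_incl_pieceMk hchart O O' h)).exists.choose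

/-- `q_U ≫ t_{U,U'} = (U ↪ U') ≫ q_{U'}`. [cite: MumfordAV1970, §7 Thm. p. 66 (proof)] -/
@[reassoc]
theorem pieceMk_transition (O O' : StableAffineOpens G X) (h : O ≤ O') :
    pieceMk hchart O ≫ transition hchart O O' h = StableAffineOpens.incl h ≫ pieceMk hchart O' :=
  (existsUnique_desc_pieceMk hchart O _ (actOpen_incl_pieceMk hchart O O' h)).exists.choose_spec

/-- Uniqueness of the transition. [cite: MumfordAV1970, §7 Thm. p. 66 (proof)] -/
theorem transition_unique (O O' : StableAffineOpens G X) (h : O ≤ O') {t : pieceQ hchart O ⟶ pieceQ hchart O'}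
    (ht : pieceMk hchart O ≫ t = StableAffineOpens.incl h ≫ pieceMk hchart O') : t = transition hchart O O' h :=
  (existsUnique_desc_pieceMk hchart O _ (actOpen_incl_pieceMk hchart O O' h)).unique ht (pieceMk_transition hchart O O' h)

/-- `t_{U,U} = 𝟙`. [cite: GortzWedhorn2020, §(3.5) Proposition 3.10 and Example 3.11 (p. 73)] -/
theorem transition_refl (O : StableAffineOpens G X) : transition hchart O O le_rfl = 𝟙 _ := by
  refine (transition_unique hchart O O le_rfl ?_).symm
  rw [Category.comp_id, StableAffineOpens.incl_rfl, Category.id_comp]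

/-- `t_{U,U'} ≫ t_{U',U''} = t_{U,U''}`. [cite: GortzWedhorn2020, §(3.5) Proposition 3.10 and Example 3.11 (p. 73)] -/
theorem transition_trans (O O' O'' : StableAffineOpens G X) (h : O ≤ O') (h' : O' ≤ O'') :
    transition hchart O O' h ≫ transition hchart O' O'' h' = transition hchart O O'' (h.trans h') := by
  refine transition_unique hchart O O'' (h.trans h') ?_
  rw [pieceMk_transition_assoc, pieceMk_transition, ← Category.assoc, StableAffineOpens.incl_incl]

/-! ### §3b The transitions are open immersions -/

/-- `q_U` is universally closed (it is finite). [cite: GortzWedhorn2020, §(3.5) Proposition 3.10 and Example 3.11 (p. 73)] -/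
theorem universallyClosed_pieceMk (O : StableAffineOpens G X) : UniversallyClosed (pieceMk hchart O).left := by
  haveI := isFinite_pieceMk hchart O
  infer_instance

omit hchart in
/-- The subset «`U` inside `U'`» of `U'` is the range of the inclusion `U ↪ U'`. [cite: GortzWedhorn2020, §(3.5) Proposition 3.10 and Example 3.11 (p. 73)] -/
theorem range_homOfLE {U U' : X.left.Opens} (h : U ≤ U') :
    Set.range ⇑(X.left.homOfLE h) = ⇑U'.ι ⁻¹' (U : Set ↥X.left) := by
  ext y
  constructor
  · rintro ⟨x, rfl⟩
    change (X.left.homOfLE h ≫ U'.ι) x ∈ (U : Set ↥X.left)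
    rw [Scheme.homOfLE_ι]
    exact x.2
  · intro hy
    refine ⟨⟨U'.ι y, hy⟩, ?_⟩
    apply U'.ι.isOpenEmbedding.injective
    change (X.left.homOfLE h ≫ U'.ι) _ = U'.ι y
    rw [Scheme.homOfLE_ι]
    rfl

/-- **The image `q_{U'}(U) ⊆ Q_{U'}` of a smaller stable open is OPEN** (★ `isOpen_image_of_stable`: `q_{U'}` is finite, hence universally closed,
and surjective; `U ⊆ U'` is saturated). [cite: MumfordAV1970, §12 Theorem 1 and its proof (pp. 111–115)] -/
def imageOpen (O O' : StableAffineOpens G X) (_h : O ≤ O') : (pieceQ hchart O').left.Opens :=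
  ⟨(pieceMk hchart O').left '' ((openOverι X O'.1).left ⁻¹' (O.1 : Set ↥X.left)), by
    haveI := universallyClosed_pieceMk hchart O'
    haveI := surjective_pieceMk hchart O'
    exact isOpen_image_of_stable (actOpen G O'.1 O'.2.2) (snd G (openOver X O'.1)) (pieceMk hchart O')
      (isPullback_pieceMk hchart O') _ (O.1.isOpen.preimage (openOverι X O'.1).left.continuous)
      (O'.2.2.preimage_actOpen_eq O.2.2)⟩

/-- `q_{U'}⁻¹ (q_{U'}(U)) = U` — saturation (★ `preimage_image_eq_of_stable`). [cite: MumfordAV1970, §12 Theorem 1 and its proof (pp. 111–115)] -/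
theorem preimage_imageOpen (O O' : StableAffineOpens G X) (h : O ≤ O') :
    (pieceMk hchart O').left ⁻¹ᵁ imageOpen hchart O O' h = (openOverι X O'.1).left ⁻¹ᵁ O.1 := by
  ext1
  exact preimage_image_eq_of_stable (actOpen G O'.1 O'.2.2) (snd G (openOver X O'.1)) (pieceMk hchart O')
    (isPullback_pieceMk hchart O') _ (O'.2.2.preimage_actOpen_eq O.2.2)

/-- The image open as an `S`-scheme (non-Prop plumbing). [cite: GortzWedhorn2020, §(3.5) Proposition 3.10 and Example 3.11 (p. 73)] -/
abbrev imageOpenOver (O O' : StableAffineOpens G X) (h : O ≤ O') : Over S :=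
  Over.mk ((imageOpen hchart O O' h).ι ≫ (pieceQ hchart O').hom)

/-- Its inclusion `q_{U'}(U) ⟶ Q_{U'}` over `S` (non-Prop plumbing). [cite: GortzWedhorn2020, §(3.5) Proposition 3.10 and Example 3.11 (p. 73)] -/
abbrev imageOpenOverι (O O' : StableAffineOpens G X) (h : O ≤ O') : imageOpenOver hchart O O' h ⟶ pieceQ hchart O' :=
  Over.homMk (imageOpen hchart O O' h).ι

/-- The range of `U ↪ U' → Q_{U'}` is `q_{U'}(U)`. [cite: GortzWedhorn2020, §(3.5) Proposition 3.10 and Example 3.11 (p. 73)] -/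
theorem range_incl_pieceMk (O O' : StableAffineOpens G X) (h : O ≤ O') :
    Set.range ((StableAffineOpens.incl h).left ≫ (pieceMk hchart O').left) = Set.range (imageOpen hchart O O' h).ι := by
  rw [Scheme.Opens.range_ι]
  ext y
  constructor
  · rintro ⟨x, rfl⟩
    refine ⟨(StableAffineOpens.incl h).left x, ?_, rfl⟩
    have hx := congrArg (fun φ => φ.left x) (StableAffineOpens.incl_openOverι (X := X) h)
    simp only [Over.comp_left, Scheme.Hom.comp_apply] at hx
    change (openOverι X O'.1).left ((StableAffineOpens.incl h).left x) ∈ (O.1 : Set ↥X.left)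
    rw [hx]
    exact x.2
  · rintro ⟨z, hz, rfl⟩
    obtain ⟨x, rfl⟩ : z ∈ Set.range ⇑(X.left.homOfLE h) := by rw [range_homOfLE]; exact hz
    exact ⟨x, rfl⟩

/-- The co-restriction `U ⟶ q_{U'}(U)` of `U ↪ U' → Q_{U'}` on underlying schemes (Mathlib `IsOpenImmersion.lift`). [cite: SGA3I, Exp. V §5] -/
def corestrictLeft (O O' : StableAffineOpens G X) (h : O ≤ O') : (openOver X O.1).left ⟶ ↑(imageOpen hchart O O' h) :=
  AlgebraicGeometry.IsOpenImmersion.lift (imageOpen hchart O O' h).ι ((StableAffineOpens.incl h).left ≫ (pieceMk hchart O').left)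
    (range_incl_pieceMk hchart O O' h).le

/-- `r ≫ (q_{U'}(U) ↪ Q_{U'}) = (U ↪ U') ≫ q_{U'}` on schemes. [cite: SGA3I, Exp. V §5] -/
@[reassoc]
theorem corestrictLeft_ι (O O' : StableAffineOpens G X) (h : O ≤ O') :
    corestrictLeft hchart O O' h ≫ (imageOpen hchart O O' h).ι = (StableAffineOpens.incl h).left ≫ (pieceMk hchart O').left :=
  AlgebraicGeometry.IsOpenImmersion.lift_fac _ _ _

/-- **The co-restriction `r : U ⟶ q_{U'}(U)`** of `U ↪ U' → Q_{U'}`, over `S`. [cite: SGA3I, Exp. V §5] -/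
def corestrict (O O' : StableAffineOpens G X) (h : O ≤ O') : openOver X O.1 ⟶ imageOpenOver hchart O O' h :=
  Over.homMk (corestrictLeft hchart O O' h) (by
    change corestrictLeft hchart O O' h ≫ (imageOpen hchart O O' h).ι ≫ (pieceQ hchart O').hom = (openOver X O.1).hom
    rw [corestrictLeft_ι_assoc, Over.w (pieceMk hchart O')]
    exact Over.w (StableAffineOpens.incl h))

/-- `r ≫ (q_{U'}(U) ↪ Q_{U'}) = (U ↪ U') ≫ q_{U'}` on schemes. [cite: SGA3I, Exp. V §5] -/
@[reassoc]
theorem corestrict_left_ι (O O' : StableAffineOpens G X) (h : O ≤ O') :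
    (corestrict hchart O O' h).left ≫ (imageOpen hchart O O' h).ι = (StableAffineOpens.incl h).left ≫ (pieceMk hchart O').left :=
  corestrictLeft_ι hchart O O' h

/-- `r ≫ (q_{U'}(U) ↪ Q_{U'}) = (U ↪ U') ≫ q_{U'}` over `S`. [cite: SGA3I, Exp. V §5] -/
@[reassoc]
theorem corestrict_ι (O O' : StableAffineOpens G X) (h : O ≤ O') :
    corestrict hchart O O' h ≫ imageOpenOverι hchart O O' h = StableAffineOpens.incl h ≫ pieceMk hchart O' := by
  ext : 1
  exact corestrict_left_ι hchart O O' h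

/-- `r` is invariant: `a_U ≫ r = pr₂ ≫ r`. [cite: SGA3I, Exp. V §5] -/
theorem actOpen_corestrict (O O' : StableAffineOpens G X) (h : O ≤ O') :
    actOpen G O.1 O.2.2 ≫ corestrict hchart O O' h = snd G (openOver X O.1) ≫ corestrict hchart O O' h := by
  haveI : IsOpenImmersion (imageOpenOverι hchart O O' h).left := inferInstanceAs (IsOpenImmersion (imageOpen hchart O O' h).ι)
  haveI : Mono (imageOpenOverι hchart O O' h) := ActionRestrict.mono_of_isOpenImmersion_left _
  rw [← cancel_mono (imageOpenOverι hchart O O' h), Category.assoc, corestrict_ι, Category.assoc, corestrict_ι]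
  exact actOpen_incl_pieceMk hchart O O' h

/-- **The restricted chart square is cartesian**: `U = U' ×_{Q_{U'}} q_{U'}(U)` (saturation + Mathlib `IsOpenImmersion.isPullback`).
[cite: MumfordAV1970, §12 Theorem 1 and its proof (pp. 111–115)] -/
theorem isPullback_incl_corestrict (O O' : StableAffineOpens G X) (h : O ≤ O') :
    IsPullback (StableAffineOpens.incl h).left (corestrict hchart O O' h).left (pieceMk hchart O').left (imageOpen hchart O O' h).ι := by
  have hsat : ⇑(pieceMk hchart O').left ⁻¹' (⇑(pieceMk hchart O').left '' (⇑(openOverι X O'.1).left ⁻¹' (O.1 : Set ↥X.left))) =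
      ⇑(openOverι X O'.1).left ⁻¹' (O.1 : Set ↥X.left) :=
    preimage_image_eq_of_stable (actOpen G O'.1 O'.2.2) (snd G (openOver X O'.1)) (pieceMk hchart O')
      (isPullback_pieceMk hchart O') _ (O'.2.2.preimage_actOpen_eq O.2.2)
  have instU : IsOpenImmersion (X.left.homOfLE h) := inferInstance
  have instV : AlgebraicGeometry.IsOpenImmersion (imageOpen hchart O O' h).ι := inferInstance
  have H := @AlgebraicGeometry.IsOpenImmersion.isPullback _ _ _ _ (corestrictLeft hchart O O' h) (X.left.homOfLE h)
    (imageOpen hchart O O' h).ι (pieceMk hchart O').left instU instV (corestrictLeft_ι hchart O O' h).symm (by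
      ext x
      change x ∈ ⇑(pieceMk hchart O').left ⁻¹' Set.range ⇑(imageOpen hchart O O' h).ι ↔ x ∈ Set.range ⇑(X.left.homOfLE h)
      rw [Scheme.Opens.range_ι, range_homOfLE]
      change x ∈ ⇑(pieceMk hchart O').left ⁻¹' (⇑(pieceMk hchart O').left '' (⇑(openOverι X O'.1).left ⁻¹' (O.1 : Set ↥X.left))) ↔ _
      rw [hsat]
      exact Iff.rfl)
  exact H.flip

/-- `r` is flat (base change of `q_{U'}`). [cite: SGA3I, Exp. V §5] -/
theorem flat_corestrict (O O' : StableAffineOpens G X) (h : O ≤ O') : Flat (corestrict hchart O O' h).left :=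
  MorphismProperty.of_isPullback (P := @Flat) (isPullback_incl_corestrict hchart O O' h) (flat_pieceMk hchart O')

/-- `r` is surjective (base change of `q_{U'}`). [cite: SGA3I, Exp. V §5] -/
theorem surjective_corestrict (O O' : StableAffineOpens G X) (h : O ≤ O') : Surjective (corestrict hchart O O' h).left :=
  MorphismProperty.of_isPullback (P := @Surjective) (isPullback_incl_corestrict hchart O O' h) (surjective_pieceMk hchart O')

/-- `r` is quasi-compact (base change of `q_{U'}`). [cite: SGA3I, Exp. V §5] -/
theorem quasiCompact_corestrict (O O' : StableAffineOpens G X) (h : O ≤ O') : QuasiCompact (corestrict hchart O O' h).left :=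
  MorphismProperty.of_isPullback (P := @QuasiCompact) (isPullback_incl_corestrict hchart O O' h) (quasiCompact_pieceMk hchart O')

/-- **THE RESTRICTED TORSOR SQUARE IS CARTESIAN**: `G ×_S U = U ×_{q_{U'}(U)} U` — paste the torsor square of `q_{U'}` with the base-change square of
`G ×_S U ⊆ G ×_S U'` and cut back along the restricted chart square. [cite: MumfordAV1970, §12 Theorem 1 and its proof (pp. 111–115)] [cite: SGA3I, Exp. V §5] -/
theorem isPullback_corestrict (O O' : StableAffineOpens G X) (h : O ≤ O') :
    IsPullback (actOpen G O.1 O.2.2).left (snd G (openOver X O.1)).left (corestrict hchart O O' h).left (corestrict hchart O O' h).left := by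
  have E := isPullback_whiskerLeft_left_snd (G := G) (StableAffineOpens.incl (X := X) h)
  have outer := E.paste_horiz (isPullback_pieceMk hchart O')
  have htop : (G ◁ StableAffineOpens.incl h).left ≫ (actOpen G O'.1 O'.2.2).left =
      (actOpen G O.1 O.2.2).left ≫ (StableAffineOpens.incl h).left := by
    rw [← Over.comp_left, ← Over.comp_left, actOpen_incl O.2.2 O'.2.2 h]
  have hbot : (StableAffineOpens.incl h).left ≫ (pieceMk hchart O').left =
      (corestrict hchart O O' h).left ≫ (imageOpen hchart O O' h).ι := (corestrict_left_ι hchart O O' h).symm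
  rw [htop, hbot] at outer
  refine IsPullback.of_right outer ?_ (isPullback_incl_corestrict hchart O O' h)
  rw [← Over.comp_left, ← Over.comp_left, actOpen_corestrict]

/-- `U ⟶ q_{U'}(U)` is ALSO a categorical quotient of `U`: unique descent of `a_U`-invariant morphisms. [cite: SGA3I, Exp. V §5] -/
theorem existsUnique_desc_corestrict (O O' : StableAffineOpens G X) (h : O ≤ O') {W : Over S} (f : openOver X O.1 ⟶ W)
    (hf : actOpen G O.1 O.2.2 ≫ f = snd G (openOver X O.1) ≫ f) : ∃! g : imageOpenOver hchart O O' h ⟶ W, corestrict hchart O O' h ≫ g = f := by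
  haveI := flat_corestrict hchart O O' h
  haveI := surjective_corestrict hchart O O' h
  haveI := quasiCompact_corestrict hchart O O' h
  exact existsUnique_desc_of_isPullback _ _ _ (isPullback_corestrict hchart O O' h) f hf

/-- The comparison `Q_U ⟶ q_{U'}(U)` (descent of `r` through `q_U`). [cite: SGA3I, Exp. V §5] -/
def toImage (O O' : StableAffineOpens G X) (h : O ≤ O') : pieceQ hchart O ⟶ imageOpenOver hchart O O' h :=
  (existsUnique_desc_pieceMk hchart O _ (actOpen_corestrict hchart O O' h)).exists.choose

/-- `q_U ≫ toImage = r`. [cite: SGA3I, Exp. V §5] -/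
@[reassoc]
theorem pieceMk_toImage (O O' : StableAffineOpens G X) (h : O ≤ O') :
    pieceMk hchart O ≫ toImage hchart O O' h = corestrict hchart O O' h :=
  (existsUnique_desc_pieceMk hchart O _ (actOpen_corestrict hchart O O' h)).exists.choose_spec

/-- The comparison `q_{U'}(U) ⟶ Q_U` (descent of `q_U` through `r`). [cite: SGA3I, Exp. V §5] -/
def ofImage (O O' : StableAffineOpens G X) (h : O ≤ O') : imageOpenOver hchart O O' h ⟶ pieceQ hchart O :=
  (existsUnique_desc_corestrict hchart O O' h _ (actOpen_pieceMk hchart O)).exists.choose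

/-- `r ≫ ofImage = q_U`. [cite: SGA3I, Exp. V §5] -/
@[reassoc]
theorem corestrict_ofImage (O O' : StableAffineOpens G X) (h : O ≤ O') :
    corestrict hchart O O' h ≫ ofImage hchart O O' h = pieceMk hchart O :=
  (existsUnique_desc_corestrict hchart O O' h _ (actOpen_pieceMk hchart O)).exists.choose_spec

/-- **Two categorical quotients of `U` differ by an isomorphism**: `toImage ≫ ofImage = 𝟙`. [cite: SGA3I, Exp. V §5] -/
theorem toImage_ofImage (O O' : StableAffineOpens G X) (h : O ≤ O') : toImage hchart O O' h ≫ ofImage hchart O O' h = 𝟙 _ :=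
  (existsUnique_desc_pieceMk hchart O _ (actOpen_pieceMk hchart O)).unique
    (by rw [pieceMk_toImage_assoc, corestrict_ofImage]) (Category.comp_id _)

/-- … and `ofImage ≫ toImage = 𝟙`. [cite: SGA3I, Exp. V §5] -/
theorem ofImage_toImage (O O' : StableAffineOpens G X) (h : O ≤ O') : ofImage hchart O O' h ≫ toImage hchart O O' h = 𝟙 _ :=
  (existsUnique_desc_corestrict hchart O O' h _ (actOpen_corestrict hchart O O' h)).unique
    (by rw [corestrict_ofImage_assoc, pieceMk_toImage]) (Category.comp_id _)

/-- `Q_U ≅ q_{U'}(U)` over `S`. [cite: SGA3I, Exp. V §5] -/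
def isoImage (O O' : StableAffineOpens G X) (h : O ≤ O') : pieceQ hchart O ≅ imageOpenOver hchart O O' h where
  hom := toImage hchart O O' h
  inv := ofImage hchart O O' h
  hom_inv_id := toImage_ofImage hchart O O' h
  inv_hom_id := ofImage_toImage hchart O O' h

/-- The transition factors as `Q_U ≅ q_{U'}(U) ↪ Q_{U'}`. [cite: MumfordAV1970, §7 Thm. p. 66 (proof)] -/
theorem transition_eq_toImage_ι (O O' : StableAffineOpens G X) (h : O ≤ O') :
    transition hchart O O' h = toImage hchart O O' h ≫ imageOpenOverι hchart O O' h :=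
  (transition_unique hchart O O' h (by rw [pieceMk_toImage_assoc, corestrict_ι])).symm

/-- **THE TRANSITIONS ARE OPEN IMMERSIONS** (an isomorphism followed by the inclusion of the open `q_{U'}(U)`). [cite: MumfordAV1970, §7 Thm. p. 66 (proof)] -/
theorem isOpenImmersion_transition (O O' : StableAffineOpens G X) (h : O ≤ O') : IsOpenImmersion (transition hchart O O' h).left := by
  rw [transition_eq_toImage_ι, Over.comp_left]
  haveI : IsIso (toImage hchart O O' h).left := (Over.forget S).map_isIso (isoImage hchart O O' h).hom |> fun _ =>
    inferInstanceAs (IsIso ((Over.forget S).map (isoImage hchart O O' h).hom))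
  haveI : IsOpenImmersion (imageOpenOverι hchart O O' h).left := inferInstanceAs (IsOpenImmersion (imageOpen hchart O O' h).ι)
  infer_instance

/-! ## §4 The locally directed diagram `U ↦ Q_U`, its gluing `Q`, and the quotient map `π : X ⟶ Q` -/

section Glue

/-- **The gluing diagram** `U ↦ Q_U` on the poset of stable affine opens, with the open-immersion transitions ([MumfordAV1970] §7: «we glue»;
[GortzWedhorn2020] §(3.5) Prop. 3.10). [cite: MumfordAV1970, §7 Thm. p. 66 (proof)] -/
def glueFunctor : StableAffineOpens G X ⥤ Scheme.{u} where
  obj O := (pieceQ hchart O).left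
  map {O O'} f := (transition hchart O O' f.le).left
  map_id O := by
    change (transition hchart O O le_rfl).left = 𝟙 _
    rw [transition_refl]
    rfl
  map_comp {O O' O''} f g := by
    rw [← Over.comp_left, transition_trans]

/-- The diagram on objects. [cite: GortzWedhorn2020, §(3.5) Proposition 3.10 and Example 3.11 (p. 73)] -/
@[simp]
theorem glueFunctor_obj (O : StableAffineOpens G X) : (glueFunctor hchart).obj O = (pieceQ hchart O).left := rfl

/-- The diagram on morphisms. [cite: GortzWedhorn2020, §(3.5) Proposition 3.10 and Example 3.11 (p. 73)] -/
theorem glueFunctor_map {O O' : StableAffineOpens G X} (f : O ⟶ O') :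
    (glueFunctor hchart).map f = (transition hchart O O' f.le).left := rfl

/-- `q_U ≫ (Q_U → Q_{U'}) = (U ↪ U') ≫ q_{U'}` on schemes. [cite: GortzWedhorn2020, §(3.5) Proposition 3.10 and Example 3.11 (p. 73)] -/
@[reassoc]
theorem pieceMk_glueFunctor_map {O O' : StableAffineOpens G X} (f : O ⟶ O') :
    (pieceMk hchart O).left ≫ (glueFunctor hchart).map f = (StableAffineOpens.incl f.le).left ≫ (pieceMk hchart O').left := by
  have h := congrArg CommaMorphism.left (pieceMk_transition hchart O O' f.le)
  simp only [Over.comp_left] at h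
  exact h

/-- The transition maps of the diagram are open immersions. [cite: MumfordAV1970, §7 Thm. p. 66 (proof)] -/
instance isOpenImmersion_glueFunctor_map {O O' : StableAffineOpens G X} (f : O ⟶ O') :
    IsOpenImmersion ((glueFunctor hchart).map f) :=
  isOpenImmersion_transition hchart O O' f.le

/-- The transition maps are injective on points. [cite: GortzWedhorn2020, §(3.5) Proposition 3.10 and Example 3.11 (p. 73)] -/
theorem glueFunctor_map_injective {O O' : StableAffineOpens G X} (f : O ⟶ O') :
    Function.Injective ((glueFunctor hchart).map f) :=
  ((glueFunctor hchart).map f).isOpenEmbedding.injective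

omit hchart in
/-- Pointwise saturation inside a bigger stable open: for `t ∈ G ×_S U'` with `a_{U'} t ∈ U` also `pr₂ t ∈ U`.
[cite: MumfordAV1970, §12 Theorem 1 and its proof (pp. 111–115)] -/
theorem snd_mem_of_actOpen_mem (O O' : StableAffineOpens G X) (t : ↥(G ⊗ openOver X O'.1).left)
    (ht : (openOverι X O'.1).left ((actOpen G O'.1 O'.2.2).left t) ∈ (O.1 : Set ↥X.left)) :
    (openOverι X O'.1).left ((snd G (openOver X O'.1)).left t) ∈ (O.1 : Set ↥X.left) := by
  have h := O'.2.2.preimage_actOpen_eq O.2.2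
  have ht' : t ∈ (actOpen G O'.1 O'.2.2).left ⁻¹' ((openOverι X O'.1).left ⁻¹' (O.1 : Set ↥X.left)) := ht
  rw [h] at ht'
  exact ht'

variable [X.left.IsSeparated]

/-- **The diagram is locally directed**: a point of `Q_{U_k}` in the images of `Q_{U_i}` and `Q_{U_j}` comes from `Q_{U_i ∩ U_j}` — its `q_{U_k}`-fibre is one `a`-orbit
(★ `exists_eq_act_eq_snd`) meeting `U_i` and `U_j`, and `U_i` is stable. [cite: GortzWedhorn2020, §(3.5) Proposition 3.10 and Example 3.11 (p. 73)] -/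
instance isLocallyDirected_glueFunctor : (glueFunctor hchart ⋙ Scheme.forget).IsLocallyDirected where
  cond {Oi Oj Ok} fi fj xi xj hx := by
    change (glueFunctor hchart).map fi xi = (glueFunctor hchart).map fj xj at hx
    haveI := surjective_pieceMk hchart Oi
    haveI := surjective_pieceMk hchart Oj
    obtain ⟨yi, rfl⟩ := (pieceMk hchart Oi).left.surjective xi
    obtain ⟨yj, rfl⟩ := (pieceMk hchart Oj).left.surjective xj
    -- in `Q_k` the images agree: the two points of `U_k` lie in one `a`-orbit
    have p1 := congrArg (fun φ => φ yi) (pieceMk_glueFunctor_map hchart fi)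
    have p2 := congrArg (fun φ => φ yj) (pieceMk_glueFunctor_map hchart fj)
    simp only [Scheme.Hom.comp_apply] at p1 p2
    have hk : (pieceMk hchart Ok).left ((StableAffineOpens.incl fi.le).left yi) =
        (pieceMk hchart Ok).left ((StableAffineOpens.incl fj.le).left yj) := p1.symm.trans (hx.trans p2)
    obtain ⟨t, ht1, ht2⟩ := exists_eq_act_eq_snd (actOpen G Ok.1 Ok.2.2) (snd G (openOver X Ok.1)) (pieceMk hchart Ok)
      (isPullback_pieceMk hchart Ok) _ _ hk
    -- `a t = yi ∈ U_i`, hence `pr₂ t = yj ∈ U_i`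
    have hyi : (openOverι X Ok.1).left ((actOpen G Ok.1 Ok.2.2).left t) ∈ (Oi.1 : Set ↥X.left) := by
      rw [ht1]
      have e := congrArg (fun φ => φ.left yi) (StableAffineOpens.incl_openOverι (X := X) fi.le)
      simp only [Over.comp_left, Scheme.Hom.comp_apply] at e
      rw [e]
      exact yi.2
    have hyj : (openOverι X Ok.1).left ((StableAffineOpens.incl fj.le).left yj) ∈ (Oi.1 : Set ↥X.left) := by
      rw [← ht2]
      exact snd_mem_of_actOpen_mem Oi Ok t hyi
    have hyjX : (yj.1 : ↥X.left) ∈ Oi.1 := by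
      have e := congrArg (fun φ => φ.left yj) (StableAffineOpens.incl_openOverι (X := X) fj.le)
      simp only [Over.comp_left, Scheme.Hom.comp_apply] at e
      rw [e] at hyj
      exact hyj
    -- the point of `U_i ∩ U_j`
    have hli : (StableAffineOpens.inf Oi Oj).1 ≤ Oi.1 := inf_le_left
    have hlj : (StableAffineOpens.inf Oi Oj).1 ≤ Oj.1 := inf_le_right
    let y : ↥(openOver X (StableAffineOpens.inf Oi Oj).1).left := (⟨yj.1, hyjX, yj.2⟩ : ↥(Oi.1 ⊓ Oj.1))
    have hyj' : (StableAffineOpens.incl hlj).left y = yj := by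
      apply Subtype.ext
      exact Scheme.homOfLE_apply hlj y
    have hyk : (StableAffineOpens.incl (hli.trans fi.le)).left y = (StableAffineOpens.incl fj.le).left yj := by
      apply Subtype.ext
      exact (Scheme.homOfLE_apply (hli.trans fi.le) y).trans (Scheme.homOfLE_apply fj.le yj).symm
    refine ⟨StableAffineOpens.inf Oi Oj, homOfLE (StableAffineOpens.inf_le_left' Oi Oj), homOfLE (StableAffineOpens.inf_le_right' Oi Oj),
      (pieceMk hchart (StableAffineOpens.inf Oi Oj)).left y, ?_, ?_⟩
    · -- compare in `Q_k` through the injective transition `Q_i → Q_k`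
      apply glueFunctor_map_injective hchart fi
      have q1 := congrArg (fun φ => φ y)
        (pieceMk_glueFunctor_map hchart (homOfLE (StableAffineOpens.inf_le_left' Oi Oj) ≫ fi))
      simp only [Scheme.Hom.comp_apply, Functor.map_comp] at q1
      change (glueFunctor hchart).map fi ((glueFunctor hchart).map (homOfLE _) ((pieceMk hchart _).left y)) = _
      refine q1.trans ?_
      refine (congrArg ((pieceMk hchart Ok).left) hyk).trans ?_
      exact p2.symm.trans hx.symm
    · have q1 := congrArg (fun φ => φ y) (pieceMk_glueFunctor_map hchart (homOfLE (StableAffineOpens.inf_le_right' Oi Oj)))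
      simp only [Scheme.Hom.comp_apply] at q1
      change (glueFunctor hchart).map (homOfLE _) ((pieceMk hchart _).left y) = _
      exact q1.trans (congrArg ((pieceMk hchart Oj).left) hyj')

/-- **The glued quotient scheme `Q`** (Mathlib's colimit of a locally directed diagram of open immersions). [cite: GortzWedhorn2020, §(3.5) Proposition 3.10 and Example 3.11 (p. 73)] -/
def glued : Scheme.{u} := colimit (glueFunctor hchart)

/-- The chart `Q_U ⟶ Q`. [cite: GortzWedhorn2020, §(3.5) Proposition 3.10 and Example 3.11 (p. 73)] -/
def gluedι (O : StableAffineOpens G X) : (pieceQ hchart O).left ⟶ glued hchart := colimit.ι (glueFunctor hchart) O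

/-- The charts are open immersions. [cite: GortzWedhorn2020, §(3.5) Proposition 3.10 and Example 3.11 (p. 73)] -/
instance isOpenImmersion_gluedι (O : StableAffineOpens G X) : IsOpenImmersion (gluedι hchart O) :=
  inferInstanceAs (IsOpenImmersion (colimit.ι (glueFunctor hchart) O))

/-- The charts are compatible with the transitions. [cite: GortzWedhorn2020, §(3.5) Proposition 3.10 and Example 3.11 (p. 73)] -/
@[reassoc (attr := simp)]
theorem glueFunctor_map_gluedι {O O' : StableAffineOpens G X} (f : O ⟶ O') :
    (glueFunctor hchart).map f ≫ gluedι hchart O' = gluedι hchart O :=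
  colimit.w (glueFunctor hchart) f

/-- The charts are jointly surjective. [cite: GortzWedhorn2020, §(3.5) Proposition 3.10 and Example 3.11 (p. 73)] -/
theorem gluedι_jointly_surjective (z : ↥(glued hchart)) : ∃ (O : StableAffineOpens G X) (q : ↥(pieceQ hchart O).left), gluedι hchart O q = z :=
  Scheme.IsLocallyDirected.ι_jointly_surjective (glueFunctor hchart) z

/-- When two chart points agree in `Q`. [cite: GortzWedhorn2020, §(3.5) Proposition 3.10 and Example 3.11 (p. 73)] -/
theorem gluedι_eq_iff {O O' : StableAffineOpens G X} {q : ↥(pieceQ hchart O).left} {q' : ↥(pieceQ hchart O').left} :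
    gluedι hchart O q = gluedι hchart O' q' ↔
      ∃ (O'' : StableAffineOpens G X) (f : O'' ⟶ O) (f' : O'' ⟶ O') (q'' : ↥(pieceQ hchart O'').left),
        (glueFunctor hchart).map f q'' = q ∧ (glueFunctor hchart).map f' q'' = q' :=
  Scheme.IsLocallyDirected.ι_eq_ι_iff (glueFunctor hchart)

/-- The cocone of structure morphisms `Q_U → S` under the diagram. [cite: GortzWedhorn2020, §(3.5) Proposition 3.10 and Example 3.11 (p. 73)] -/
def gluedCocone : Cocone (glueFunctor hchart) :=
  Cocone.mk S
    { app := fun O => (pieceQ hchart O).hom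
      naturality := fun O O' f => by
        change (transition hchart O O' f.le).left ≫ (pieceQ hchart O').hom = (pieceQ hchart O).hom ≫ 𝟙 S
        rw [Over.w, Category.comp_id] }

/-- The structure morphism `Q ⟶ S`, glued from the `Q_U → S`. [cite: GortzWedhorn2020, §(3.5) Proposition 3.10 and Example 3.11 (p. 73)] -/
def gluedHom : glued hchart ⟶ S :=
  colimit.desc (glueFunctor hchart) (gluedCocone hchart)

/-- `(Q_U ↪ Q) ≫ (Q → S) = (Q_U → S)`. [cite: GortzWedhorn2020, §(3.5) Proposition 3.10 and Example 3.11 (p. 73)] -/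
@[reassoc (attr := simp)]
theorem gluedι_gluedHom (O : StableAffineOpens G X) : gluedι hchart O ≫ gluedHom hchart = (pieceQ hchart O).hom :=
  colimit.ι_desc (C := Scheme.{u}) (gluedCocone hchart) O

/-- **The glued quotient `Q` as an `S`-scheme.** [cite: MumfordAV1970, §12 Theorem 1 (p. 111)] -/
def gluedOver : Over S := Over.mk (gluedHom hchart)

/-- The chart `Q_U ⟶ Q` over `S`. [cite: MumfordAV1970, §12 Theorem 1 (p. 111)] -/
def gluedιOver (O : StableAffineOpens G X) : pieceQ hchart O ⟶ gluedOver hchart :=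
  Over.homMk (gluedι hchart O) (gluedι_gluedHom hchart O)

variable (hcov : ∀ x : ↥X.left, ∃ U : X.left.Opens, x ∈ U ∧ IsAffineOpen U ∧ IsStable G U)
include hcov

omit hchart [X.left.IsSeparated] in
/-- Every point lies in an index. [cite: MumfordAV1970, §7 Thm. p. 66 (hypothesis)] -/
theorem exists_mem_index (x : ↥X.left) : ∃ O : StableAffineOpens G X, x ∈ O.1 := by
  obtain ⟨U, hx, hU, hst⟩ := hcov x
  exact ⟨⟨U, hU, hst⟩, hx⟩

omit hchart [X.left.IsSeparated] in
/-- The open cover of `X` by the indices. [cite: MumfordAV1970, §7 Thm. p. 66 (hypothesis)] -/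
def stableCover : X.left.OpenCover :=
  X.left.openCoverOfIsOpenCover (fun O : StableAffineOpens G X => O.1) (by
    change (⨆ O : StableAffineOpens G X, O.1) = ⊤
    rw [eq_top_iff]
    rintro x -
    obtain ⟨O, hO⟩ := exists_mem_index hcov x
    exact Opens.mem_iSup.mpr ⟨O, hO⟩)

omit hcov in
/-- The local quotient maps `U → Q_U ↪ Q` agree on overlaps. [cite: MumfordAV1970, §7 Thm. p. 66 (proof)] -/
theorem pieceMk_gluedι_compatible (O O' : StableAffineOpens G X) :
    X.left.homOfLE (inf_le_left : O.1 ⊓ O'.1 ≤ O.1) ≫ (pieceMk hchart O).left ≫ gluedι hchart O =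
      X.left.homOfLE (inf_le_right : O.1 ⊓ O'.1 ≤ O'.1) ≫ (pieceMk hchart O').left ≫ gluedι hchart O' := by
  let l := StableAffineOpens.inf O O'
  have h1 := pieceMk_glueFunctor_map_assoc hchart (homOfLE (StableAffineOpens.inf_le_left' O O')) (gluedι hchart O)
  have h2 := pieceMk_glueFunctor_map_assoc hchart (homOfLE (StableAffineOpens.inf_le_right' O O')) (gluedι hchart O')
  have k1 : (StableAffineOpens.incl _).left ≫ (pieceMk hchart O).left ≫ gluedι hchart O = (pieceMk hchart l).left ≫ gluedι hchart l :=
    h1.symm.trans (congrArg ((pieceMk hchart l).left ≫ ·) (glueFunctor_map_gluedι hchart _))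
  have k2 : (StableAffineOpens.incl _).left ≫ (pieceMk hchart O').left ≫ gluedι hchart O' = (pieceMk hchart l).left ≫ gluedι hchart l :=
    h2.symm.trans (congrArg ((pieceMk hchart l).left ≫ ·) (glueFunctor_map_gluedι hchart _))
  exact k1.trans k2.symm

/-- **The quotient map `π : X ⟶ Q` on schemes**, glued from the `U → Q_U ↪ Q`. [cite: MumfordAV1970, §7 Thm. p. 66 (proof)] -/
def gluedMk : X.left ⟶ glued hchart :=
  Scheme.Cover.glueMorphisms (stableCover hcov) (fun O => (pieceMk hchart O).left ≫ gluedι hchart O) (by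
    intro O O'
    have H := isPullback_opens_inf O.1 O'.1
    change pullback.fst O.1.ι O'.1.ι ≫ _ = pullback.snd O.1.ι O'.1.ι ≫ _
    rw [← H.isoPullback_inv_fst, ← H.isoPullback_inv_snd, Category.assoc, Category.assoc]
    exact congrArg (H.isoPullback.inv ≫ ·) (pieceMk_gluedι_compatible hchart O O'))

/-- `π` restricted to an index `U` is `U → Q_U ↪ Q`. [cite: MumfordAV1970, §7 Thm. p. 66 (proof)] -/
@[reassoc]
theorem ι_gluedMk (O : StableAffineOpens G X) :
    (openOverι X O.1).left ≫ gluedMk hchart hcov = (pieceMk hchart O).left ≫ gluedι hchart O :=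
  Scheme.Cover.ι_glueMorphisms (stableCover hcov) (fun O => (pieceMk hchart O).left ≫ gluedι hchart O) _ O

/-- Pointwise form of `ι_gluedMk`. [cite: GortzWedhorn2020, §(3.5) Proposition 3.10 and Example 3.11 (p. 73)] -/
theorem gluedMk_apply (O : StableAffineOpens G X) (x : ↥(openOver X O.1).left) :
    gluedMk hchart hcov ((openOverι X O.1).left x) = gluedι hchart O ((pieceMk hchart O).left x) :=
  congrArg (fun φ => φ x) (ι_gluedMk hchart hcov O)

/-- `π` is a morphism over `S`. [cite: GortzWedhorn2020, §(3.5) Proposition 3.10 and Example 3.11 (p. 73)] -/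
theorem gluedMk_gluedHom : gluedMk hchart hcov ≫ gluedHom hchart = X.hom := by
  refine Scheme.Cover.hom_ext (stableCover hcov) _ _ fun (O : StableAffineOpens G X) => ?_
  change (openOverι X O.1).left ≫ gluedMk hchart hcov ≫ gluedHom hchart = (openOverι X O.1).left ≫ X.hom
  rw [ι_gluedMk_assoc, gluedι_gluedHom]
  exact Over.w (pieceMk hchart O)

/-- **The quotient map `π : X ⟶ Q` over `S`.** [cite: MumfordAV1970, §12 Theorem 1 (p. 111)] -/
def gluedMkOver : X ⟶ gluedOver hchart := Over.homMk (gluedMk hchart hcov) (gluedMk_gluedHom hchart hcov)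

/-- `q_U ≫ (Q_U ↪ Q) = (U ↪ X) ≫ π` over `S`. [cite: MumfordAV1970, §7 Thm. p. 66 (proof)] -/
theorem pieceMk_gluedιOver (O : StableAffineOpens G X) :
    pieceMk hchart O ≫ gluedιOver hchart O = openOverι X O.1 ≫ gluedMkOver hchart hcov := by
  ext : 1
  exact (ι_gluedMk hchart hcov O).symm

/-! ### Properties of `π` -/

/-- **`π` is `G`-invariant**: `σ ≫ π = pr₂ ≫ π` — checked on the cover `G ×_S U` of `G ×_S X`, where it is the invariance of `q_U`.
[cite: MumfordAV1970, §12 Theorem 1 (p. 111)] -/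
theorem smul_gluedMkOver : γ[G, X] ≫ gluedMkOver hchart hcov = snd G X ≫ gluedMkOver hchart hcov := by
  ext : 1
  change (γ[G, X]).left ≫ gluedMk hchart hcov = (snd G X).left ≫ gluedMk hchart hcov
  haveI : ∀ O : StableAffineOpens G X, IsOpenImmersion (G ◁ openOverι X O.1).left :=
    fun O => isOpenImmersion_whiskerLeft_openOverι_left O.1
  let 𝒱 : (G ⊗ X).left.OpenCover := Scheme.Cover.mkOfCovers (StableAffineOpens G X) (fun O => (G ⊗ openOver X O.1).left)
    (fun O => (G ◁ openOverι X O.1).left) (fun t => by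
      obtain ⟨O, hO⟩ := exists_mem_index hcov ((snd G X).left t)
      have ht : t ∈ Set.range ((G ◁ openOverι X O.1).left) := by rw [range_whiskerLeft_openOverι_left]; exact hO
      obtain ⟨s, rfl⟩ := ht
      exact ⟨O, s, rfl⟩)
  refine Scheme.Cover.hom_ext 𝒱 _ _ fun (O : StableAffineOpens G X) => ?_
  change (G ◁ openOverι X O.1).left ≫ (γ[G, X]).left ≫ gluedMk hchart hcov = (G ◁ openOverι X O.1).left ≫ (snd G X).left ≫ gluedMk hchart hcov
  have e1 : (G ◁ openOverι X O.1).left ≫ (γ[G, X]).left = (actOpen G O.1 O.2.2).left ≫ (openOverι X O.1).left := by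
    rw [← Over.comp_left, ← actOpen_comp, Over.comp_left]
  have e2 : (G ◁ openOverι X O.1).left ≫ (snd G X).left = (snd G (openOver X O.1)).left ≫ (openOverι X O.1).left := by
    rw [← Over.comp_left, whiskerLeft_snd, Over.comp_left]
  rw [reassoc_of% e1, reassoc_of% e2, ι_gluedMk, ← Category.assoc, ← Category.assoc, ← Over.comp_left, ← Over.comp_left,
    actOpen_pieceMk]

/-- **`π⁻¹(Q_U) = U`**: the preimage of a chart is the stable affine open it comes from (saturation: a `q_{U'}`-fibre meeting `U` lies in `U`).
[cite: MumfordAV1970, §12 Theorem 1 and its proof (pp. 111–115)] -/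
theorem preimage_opensRange_gluedι (O : StableAffineOpens G X) :
    gluedMk hchart hcov ⁻¹ᵁ (gluedι hchart O).opensRange = O.1 := by
  ext x
  constructor
  · rintro ⟨p, hp⟩
    haveI := surjective_pieceMk hchart O
    obtain ⟨y, rfl⟩ := (pieceMk hchart O).left.surjective p
    obtain ⟨O', hx⟩ := exists_mem_index hcov x
    have hpx : gluedι hchart O ((pieceMk hchart O).left y) = gluedι hchart O' ((pieceMk hchart O').left ⟨x, hx⟩) := by
      rw [hp]; exact (gluedMk_apply hchart hcov O' ⟨x, hx⟩)
    obtain ⟨l, f, f', p'', h1, h2⟩ := (gluedι_eq_iff hchart).mp hpx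
    haveI := surjective_pieceMk hchart l
    obtain ⟨z, rfl⟩ := (pieceMk hchart l).left.surjective p''
    -- in `Q_{O'}`: `q_{O'}(z) = q_{O'}(x)`, so `x` lies in the `a`-orbit of `z ∈ l ⊆ O`
    have q2 := congrArg (fun φ => φ z) (pieceMk_glueFunctor_map hchart f')
    simp only [Scheme.Hom.comp_apply] at q2
    have h2' : (pieceMk hchart O').left ((StableAffineOpens.incl f'.le).left z) = (pieceMk hchart O').left ⟨x, hx⟩ := q2.symm.trans h2
    obtain ⟨t, ht1, ht2⟩ := exists_eq_act_eq_snd (actOpen G O'.1 O'.2.2) (snd G (openOver X O'.1)) (pieceMk hchart O')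
      (isPullback_pieceMk hchart O') _ _ h2'
    have hz : (openOverι X O'.1).left ((actOpen G O'.1 O'.2.2).left t) ∈ (O.1 : Set ↥X.left) := by
      rw [ht1]
      have e := congrArg (fun φ => φ.left z) (StableAffineOpens.incl_openOverι (X := X) f'.le)
      simp only [Over.comp_left, Scheme.Hom.comp_apply] at e
      rw [e]
      exact f.le z.2
    have hx' := snd_mem_of_actOpen_mem O O' t hz
    rw [ht2] at hx'
    exact hx'
  · intro hx
    exact ⟨(pieceMk hchart O).left ⟨x, hx⟩, (gluedMk_apply hchart hcov O ⟨x, hx⟩).symm⟩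

/-- **THE CHART SQUARE IS CARTESIAN**: `U = X ×_Q Q_U`. [cite: MumfordAV1970, §12 Theorem 1 and its proof (pp. 111–115)] -/
theorem isPullback_chart (O : StableAffineOpens G X) :
    IsPullback (pieceMk hchart O).left O.1.ι (gluedι hchart O) (gluedMk hchart hcov) :=
  @AlgebraicGeometry.IsOpenImmersion.isPullback _ _ _ _ (pieceMk hchart O).left O.1.ι (gluedι hchart O) (gluedMk hchart hcov)
    (inferInstanceAs (IsOpenImmersion O.1.ι)) inferInstance (ι_gluedMk hchart hcov O)
    (by rw [preimage_opensRange_gluedι]; exact (Scheme.Opens.opensRange_ι O.1).symm)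

end Glue

/-! ## §5 HEAD: the charted quotient datum -/

omit hchart in
/-- **THE CHARTED QUOTIENT DATUM (CQD)** — DEALS v8 row (7) «SPINE: LOCALLY DIRECTED GLUE».  For a group scheme `G` acting on `X` over `S` with `X`
separated, if every point of `X` lies in a `G`-stable affine open (`hcov`) and every `G`-stable affine open `U` carries, for every lift `a` of the
action, a CHART PACKAGE — an affine `Q_U` locally of finite type over `S` and a finite, flat, surjective, `a`-invariant `q : U ⟶ Q_U` with cartesian
torsor square `G ×_S U ⇉ U → Q_U` (`hchart`; ★ sheet (A) `FiniteFlatGroupSchemeQuotientAffine*` in ring form) — THEN the affine quotients glue: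
there are `π : X ⟶ Q` over `S`, `G`-INVARIANT, an index type `J` (the stable affine opens), stable affine opens `U j` with action lifts `a j`,
their chart packages `(QU j, q j)` VERBATIM, and OPEN IMMERSIONS `ιQ j : QU j ⟶ Q` covering `Q`, with `q j ≫ ιQ j = (U j ↪ X) ≫ π` and
CARTESIAN CHART SQUARES `U j = X ×_Q QU j` ([MumfordAV1970] §7 Thm. p. 66 «we glue» ∕ §12 Thm. 1; [SGA3I] V §5; [GortzWedhorn2020] §(3.5) Prop. 3.10).
Row (8) pastes the chart squares + chart torsor squares to the global torsor square and reads `π` finite ∕ flat ∕ surjective on the cover.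
[cite: MumfordAV1970, §7 Thm. p. 66 and §12 Theorem 1 (p. 111)] [cite: SGA3I, Exp. V §5] [cite: GortzWedhorn2020, §(3.5) Proposition 3.10 and Example 3.11 (p. 73)] -/
theorem exists_chartedQuotientDatum [X.left.IsSeparated]
    (hcov : ∀ x : ↥X.left, ∃ U : X.left.Opens, x ∈ U ∧ IsAffineOpen U ∧
      Set.range ((G ◁ (Over.homMk U.ι : Over.mk (U.ι ≫ X.hom) ⟶ X)) ≫ γ[G, X]).left ⊆ (U : Set ↥X.left))
    (hchart : ∀ (U : X.left.Opens), IsAffineOpen U →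
      ∀ (a : G ⊗ Over.mk (U.ι ≫ X.hom) ⟶ Over.mk (U.ι ≫ X.hom)),
        a ≫ (Over.homMk U.ι : Over.mk (U.ι ≫ X.hom) ⟶ X) = (G ◁ (Over.homMk U.ι : Over.mk (U.ι ≫ X.hom) ⟶ X)) ≫ γ[G, X] →
      ∃ (QU : Over S) (q : Over.mk (U.ι ≫ X.hom) ⟶ QU),
        IsAffine QU.left ∧ LocallyOfFiniteType QU.hom ∧ IsFinite q.left ∧ Flat q.left ∧ Surjective q.left ∧
        a ≫ q = snd G (Over.mk (U.ι ≫ X.hom)) ≫ q ∧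
        IsPullback a.left (snd G (Over.mk (U.ι ≫ X.hom))).left q.left q.left) :
    ∃ (Q : Over S) (π : X ⟶ Q) (J : Type u) (U : J → X.left.Opens)
      (a : ∀ j, G ⊗ Over.mk ((U j).ι ≫ X.hom) ⟶ Over.mk ((U j).ι ≫ X.hom))
      (QU : J → Over S) (q : ∀ j, Over.mk ((U j).ι ≫ X.hom) ⟶ QU j) (ιQ : ∀ j, QU j ⟶ Q),
      γ[G, X] ≫ π = snd G X ≫ π ∧
      (∀ j, IsOpenImmersion (ιQ j).left) ∧
      (∀ y : ↥Q.left, ∃ j, y ∈ Set.range (ιQ j).left) ∧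
      ∀ j, IsAffineOpen (U j) ∧
        a j ≫ (Over.homMk (U j).ι : Over.mk ((U j).ι ≫ X.hom) ⟶ X) =
          (G ◁ (Over.homMk (U j).ι : Over.mk ((U j).ι ≫ X.hom) ⟶ X)) ≫ γ[G, X] ∧
        q j ≫ ιQ j = (Over.homMk (U j).ι : Over.mk ((U j).ι ≫ X.hom) ⟶ X) ≫ π ∧
        IsPullback (q j).left (U j).ι (ιQ j).left π.left ∧
        IsAffine (QU j).left ∧ LocallyOfFiniteType (QU j).hom ∧
        IsFinite (q j).left ∧ Flat (q j).left ∧ Surjective (q j).left ∧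
        a j ≫ q j = snd G (Over.mk ((U j).ι ≫ X.hom)) ≫ q j ∧
        IsPullback (a j).left (snd G (Over.mk ((U j).ι ≫ X.hom))).left (q j).left (q j).left := by
  have hcov' : ∀ x : ↥X.left, ∃ U : X.left.Opens, x ∈ U ∧ IsAffineOpen U ∧ IsStable G U := hcov
  refine ⟨gluedOver hchart, gluedMkOver hchart hcov', StableAffineOpens G X, fun O => O.1, fun O => actOpen G O.1 O.2.2,
    fun O => pieceQ hchart O, fun O => pieceMk hchart O, fun O => gluedιOver hchart O,
    smul_gluedMkOver hchart hcov', fun O => isOpenImmersion_gluedι hchart O, ?_, fun O => ?_⟩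
  · intro y
    obtain ⟨O, p, hp⟩ := gluedι_jointly_surjective hchart y
    exact ⟨O, p, hp⟩
  · exact ⟨O.2.1, actOpen_comp O.1 O.2.2, pieceMk_gluedιOver hchart hcov' O, isPullback_chart hchart hcov' O, isAffine_pieceQ hchart O,
      locallyOfFiniteType_pieceQ hchart O, isFinite_pieceMk hchart O, flat_pieceMk hchart O, surjective_pieceMk hchart O,
      actOpen_pieceMk hchart O, isPullback_pieceMk hchart O⟩

end Construction


end Literature.AlgebraicGeometry.RelativeSpec.TorsorQuotient

end
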